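import Summits.RiemannHypothesis.RiemannHypothesis.Theorems.UniversalFactorMediumHighWin2
import Summits.RiemannHypothesis.RiemannHypothesis.Theorems.UniversalFactorLaguerreCriterion

/-!
# RiemannHypothesis / UniversalFactor — the certificate instance `a = 16` (Lehmer's pair)
(negative-side support for crux `LaplaceLoophole`, item stmt-RiemannHypothesis-2575; serves
`LehmerPointNoGo`, stmt-RiemannHypothesis-2582)

Refuter file (compute-scan seat `lscan-RiemannHypothesis-2575`).  The Laplace(16)-smoothed transform
`F_16 = deBruijnHDiv (1 + u²/16²)` of the Pólya–de Bruijn kernel has a non-real zero.  The certificate is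
the kernel-checked DIP CERTIFICATE at Lehmer's point `x₀ = 2t₀ = 14010.16` (`t₀ = UniversalFactor.lehmerT0`,
between Lehmer's zeros `γ = 7005.0629, 7005.1006` of `ζ`): `H_0(x₀) < 0` while both one-sided Laplace(16)
averages `P_16(x₀) = ∫₀^∞ H_0(x₀ − y)e^{−16y}dy`, `Q_16(x₀) = ∫₀^∞ H_0(x₀ + y)e^{−16y}dy` are positive — the
box `a ∈ [16, 22]` of the compiled t-side certificate `UniversalFactor.hiWin2_check`
(`UniversalFactorMediumHighWin2.lean`, `native_decide`, certified `ζ(½+it)` at 1168 Gauss–Legendre nodes) read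
through `UniversalFactor.stub_highWindow2`, and the Laguerre-inequality criterion
`UniversalFactor.not_hasOnlyRealZeros_of_dip_certificate` (`UniversalFactorLaguerreCriterion.lean`).
This is the one-point (Laguerre) form of the close-pair certificate: the pair-signs form
`UniversalFactor.not_hasOnlyRealZeros_of_pair_signs_PQ` needs `P + Q ≠ 0`, `Q ≠ 0` on x-INTERVALS at height
14010, which the tree's t-side evaluator (one point `x₀`) does not provide; the dip form needs the three
numbers at `x₀` only and is what the compiled certificate verifies (numerically `F_16` has the non-real zero
`z ≈ 14010.1634 + 0.0797 i`, kit j004904).  The route item `LehmerPointNoGo` is this statement verbatim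
(`deBruijnHDiv_laplace_eq` is `rfl`); a prover closes it by `exact` this theorem.
-/

noncomputable section

set_option linter.dupNamespace false

namespace Summit.RiemannHypothesis.RiemannHypothesis.Theorems

open MeasureTheory Set
open Literature.NumberTheory.LFunctions

/-- **`F_16` has a non-real zero** (the Lehmer-point instance of generalised Newman on the Laplace ray):
dip certificate `H_0(x₀) < 0 < P_16(x₀), Q_16(x₀)` at `x₀ = 2·lehmerT0 = 14010.16` from the compiled window
`stub_highWindow2` (`4 ≤ 16 ≤ 32`), then `not_hasOnlyRealZeros_of_dip_certificate`. [folklore] -/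
theorem UniversalFactor.not_hasOnlyRealZeros_laplace_sixteen :
    ¬ HasOnlyRealZeros (deBruijnHDiv fun u : ℝ => 1 + u ^ 2 / (16:ℝ) ^ 2) := by
  obtain ⟨hH, hP, hQ⟩ := UniversalFactor.stub_highWindow2 16 (by norm_num) (by norm_num)
  exact UniversalFactor.not_hasOnlyRealZeros_of_dip_certificate (by norm_num)
    (by unfold UniversalFactor.lehmerT0 UniversalFactor.lehmerT0N UniversalFactor.lehmerT0D; norm_num) hH hP hQ

/-- The same instance in the route's inline form (the cosine transform of `Φ(u)/(1 + u²/16²)`), i.e. the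
body of `UniversalFactor.LehmerPointNoGo` up to `deBruijnHDiv_laplace_eq = rfl`. [folklore] -/
theorem UniversalFactor.not_hasOnlyRealZeros_laplace_sixteen' :
    ¬ HasOnlyRealZeros (fun z : ℂ => ∫ u in Set.Ioi (0:ℝ),
      ((deBruijnPhi u / (1 + u ^ 2 / (16:ℝ) ^ 2) : ℝ) : ℂ) * Complex.cos (z * u)) :=
  UniversalFactor.not_hasOnlyRealZeros_laplace_sixteen

end Summit.RiemannHypothesis.RiemannHypothesis.Theorems
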